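import Literature.Analysis.FluidPDE.VorticityCalculus
import Literature.Analysis.FluidPDE.VectorCalculusProofs
import Literature.Analysis.FluidPDE.WholeSpaceIBP
import Mathlib.Analysis.Calculus.BumpFunction.Normed
import HarnessLib

/-!
# Functional mining: an explicit harmonic quadratic field on `ℝ³` (no-go branch, row C1)

Search for candidate a priori estimates; no regularity claim.

Cell `pub-nsfunc` (host summit NavierStokesRegularity, topic `FunctionalMining`), NO-GO branch,
target `EnstrophyQuadraticBudget C` (`RateBudgets.lean`, census row C1). By
`QuadraticBudgetStatic.lean` the row dies for EVERY `C` once a smooth divergence-free field with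
non-zero enstrophy production `∫⟪(U·∇)U, ΔU⟫` supported in a small ball is planted on `T³` and
concentrated. This file is the EXPLICIT-CALCULUS part of the construction of such a field on
`ℝ³ = EuclideanSpace ℝ (Fin 3)` (companion `QuadraticBudgetWitness.lean` does the analysis):

* `BumpWitness.pot y = (0, y₂³/3, y₁³/3 − y₀²y₂/2)` (a cubic vector potential),
  `BumpWitness.vQ y = (y₁² − y₂², y₀y₂, 0) = curl pot` (`curl_pot`): a HARMONIC (`laplacian_vQ`)
  divergence-free quadratic field;
* `BumpWitness.nQ y = (2y₀y₁y₂, y₁²y₂ − y₂³, 0) = (vQ·∇)vQ` (`convect_vQ`), with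
  `⟪curl nQ, e₀⟫ = 3y₂² − y₁²` (`curl_nQ_zero`) and `Δ(3y₂² − y₁²) = 4` (`laplacian_curl_nQ_zero`);
* the constant `4 ≠ 0` is the whole point: it is the linear coefficient (per unit mass of the
  perturbing bump) of the enstrophy production along the perturbation `vQ + ε curl(β e₀)`, so the
  production cannot vanish identically on compactly supported divergence-free fields
  (found by a symbolic search over quadratic divergence-free fields, cell folder `work/sym/`).

Everything here is finite-dimensional calculus of explicit polynomial maps (Mathlib `HasFDerivAt`
algebra, the tree's `curl`/`curlCLM` of `FluidPDE/TaoEnstrophyLocalisation`,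
`laplacian_eq_sum_fderiv_fderiv` of `FluidPDE/WholeSpaceIBP`).
-/

noncomputable section

open MeasureTheory Set Filter Topology InnerProductSpace
open scoped RealInnerProductSpace Laplacian ContDiff

namespace Summit.NavierStokesRegularity.FunctionalMining

open Literature.Analysis.FluidPDE

/-- Local notation for physical space `ℝ³ = EuclideanSpace ℝ (Fin 3)`. -/
local notation "ℝ³" => EuclideanSpace ℝ (Fin 3)

namespace BumpWitness

/-! ## Coordinates and unit vectors -/

/-- The unit vector `eᵢ = EuclideanSpace.single i 1` of `ℝ³` (abbreviation; `simp [e]` evaluates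
its coordinates). [folklore] -/
def e (i : Fin 3) : ℝ³ := EuclideanSpace.single i 1

/-- The coordinate functional `y ↦ yᵢ` as a continuous linear map (`EuclideanSpace.proj`).
[folklore] -/
def crd (i : Fin 3) : ℝ³ →L[ℝ] ℝ := EuclideanSpace.proj i

/-- The coordinate functionals are their own derivatives. [folklore] -/
theorem hasFDerivAt_coord (i : Fin 3) (y : ℝ³) : HasFDerivAt (fun z : ℝ³ => z i) (crd i) y :=
  (crd i).hasFDerivAt

/-! ## The cubic potential and the harmonic quadratic field -/

/-- The cubic vector potential `pot y = (0, y₂³/3, y₁³/3 − y₀² y₂/2)`. -/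
def pot (y : ℝ³) : ℝ³ := (3⁻¹ * y 2 ^ 3) • e 1 + (3⁻¹ * y 1 ^ 3 - 2⁻¹ * (y 0 ^ 2 * y 2)) • e 2

/-- The harmonic, divergence-free quadratic field `vQ y = (y₁² − y₂², y₀ y₂, 0)` (`= curl pot`). -/
def vQ (y : ℝ³) : ℝ³ := (y 1 ^ 2 - y 2 ^ 2) • e 0 + (y 0 * y 2) • e 1

/-- Its self-convection `nQ y = ((vQ·∇)vQ)(y) = (2 y₀ y₁ y₂, y₁² y₂ − y₂³, 0)`. -/
def nQ (y : ℝ³) : ℝ³ := (2 * y 0 * y 1 * y 2) • e 0 + (y 1 ^ 2 * y 2 - y 2 ^ 3) • e 1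

/-- The derivative of `pot` at `y`: `h ↦ (y₂² h₂) e₁ + (y₁² h₁ − y₀ y₂ h₀ − ½ y₀² h₂) e₂`. -/
def Dpot (y : ℝ³) : ℝ³ →L[ℝ] ℝ³ :=
  ((y 2 ^ 2) • crd 2).smulRight (e 1) +
    ((y 1 ^ 2) • crd 1 - (y 0 * y 2) • crd 0 - (y 0 ^ 2 / 2) • crd 2).smulRight (e 2)

/-- The derivative of `vQ` at `y`: `h ↦ (2y₁h₁ − 2y₂h₂) e₀ + (y₂ h₀ + y₀ h₂) e₁`. -/
def DvQ (y : ℝ³) : ℝ³ →L[ℝ] ℝ³ :=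
  ((2 * y 1) • crd 1 - (2 * y 2) • crd 2).smulRight (e 0) + ((y 2) • crd 0 + (y 0) • crd 2).smulRight (e 1)

/-- The derivative of `nQ` at `y`. -/
def DnQ (y : ℝ³) : ℝ³ →L[ℝ] ℝ³ :=
  ((2 * y 1 * y 2) • crd 0 + (2 * y 0 * y 2) • crd 1 + (2 * y 0 * y 1) • crd 2).smulRight (e 0) +
    ((2 * y 1 * y 2) • crd 1 + (y 1 ^ 2 - 3 * y 2 ^ 2) • crd 2).smulRight (e 1)

/-- `D pot (y) = Dpot y`. [folklore] -/
theorem hasFDerivAt_pot (y : ℝ³) : HasFDerivAt pot (Dpot y) y := by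
  have h1 : HasFDerivAt (fun z : ℝ³ => 3⁻¹ * z 2 ^ 3) ((y 2 ^ 2) • crd 2) y := by
    have := ((hasFDerivAt_coord 2 y).pow 3).const_mul (3⁻¹ : ℝ)
    refine this.congr_fderiv ?_
    ext h
    simp [crd]
    ring
  have h2 : HasFDerivAt (fun z : ℝ³ => 3⁻¹ * z 1 ^ 3 - 2⁻¹ * (z 0 ^ 2 * z 2))
      ((y 1 ^ 2) • crd 1 - (y 0 * y 2) • crd 0 - (y 0 ^ 2 / 2) • crd 2) y := by
    have := (((hasFDerivAt_coord 1 y).pow 3).const_mul (3⁻¹ : ℝ)).sub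
      ((((hasFDerivAt_coord 0 y).pow 2).mul (hasFDerivAt_coord 2 y)).const_mul (2⁻¹ : ℝ))
    refine this.congr_fderiv ?_
    ext h
    simp [crd]
    ring
  exact (h1.smul_const (e 1)).add (h2.smul_const (e 2))

/-- `D vQ (y) = DvQ y`. [folklore] -/
theorem hasFDerivAt_vQ (y : ℝ³) : HasFDerivAt vQ (DvQ y) y := by
  have h1 : HasFDerivAt (fun z : ℝ³ => z 1 ^ 2 - z 2 ^ 2) ((2 * y 1) • crd 1 - (2 * y 2) • crd 2) y := by
    have := ((hasFDerivAt_coord 1 y).pow 2).sub ((hasFDerivAt_coord 2 y).pow 2)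
    refine this.congr_fderiv ?_
    ext h
    simp [crd]
  have h2 : HasFDerivAt (fun z : ℝ³ => z 0 * z 2) ((y 2) • crd 0 + (y 0) • crd 2) y := by
    have := (hasFDerivAt_coord 0 y).mul (hasFDerivAt_coord 2 y)
    refine this.congr_fderiv ?_
    ext h
    simp [crd]
    ring
  exact (h1.smul_const (e 0)).add (h2.smul_const (e 1))

/-- `D nQ (y) = DnQ y`. [folklore] -/
theorem hasFDerivAt_nQ (y : ℝ³) : HasFDerivAt nQ (DnQ y) y := by
  have h1 : HasFDerivAt (fun z : ℝ³ => 2 * z 0 * z 1 * z 2)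
      ((2 * y 1 * y 2) • crd 0 + (2 * y 0 * y 2) • crd 1 + (2 * y 0 * y 1) • crd 2) y := by
    have := (((hasFDerivAt_coord 0 y).const_mul 2).mul (hasFDerivAt_coord 1 y)).mul
      (hasFDerivAt_coord 2 y)
    refine this.congr_fderiv ?_
    ext h
    simp [crd]
    ring
  have h2 : HasFDerivAt (fun z : ℝ³ => z 1 ^ 2 * z 2 - z 2 ^ 3)
      ((2 * y 1 * y 2) • crd 1 + (y 1 ^ 2 - 3 * y 2 ^ 2) • crd 2) y := by
    have := (((hasFDerivAt_coord 1 y).pow 2).mul (hasFDerivAt_coord 2 y)).sub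
      ((hasFDerivAt_coord 2 y).pow 3)
    refine this.congr_fderiv ?_
    ext h
    simp [crd]
    ring
  exact (h1.smul_const (e 0)).add (h2.smul_const (e 1))

/-- `pot`, `vQ`, `nQ` are smooth (polynomial maps). [folklore] -/
theorem contDiff_pot : ContDiff ℝ ∞ pot := by
  unfold pot
  fun_prop

/-- `vQ` is smooth. [folklore] -/
theorem contDiff_vQ : ContDiff ℝ ∞ vQ := by
  unfold vQ
  fun_prop

/-- `nQ` is smooth. [folklore] -/
theorem contDiff_nQ : ContDiff ℝ ∞ nQ := by
  unfold nQ
  fun_prop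

/-! ## `curl pot = vQ`, `(vQ·∇)vQ = nQ`, `⟪curl nQ, e₀⟫ = 3y₂² − y₁²` -/

/-- **`curl pot = vQ`.** [folklore] -/
theorem curl_pot (y : ℝ³) : curl pot y = vQ y := by
  rw [curl, (hasFDerivAt_pot y).fderiv]
  ext i
  fin_cases i <;> simp [Dpot, vQ, e, crd]

/-- **`(vQ·∇)vQ = nQ`**: `D vQ (y) (vQ y) = nQ y`. [folklore] -/
theorem convect_vQ (y : ℝ³) : fderiv ℝ vQ y (vQ y) = nQ y := by
  rw [(hasFDerivAt_vQ y).fderiv]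
  ext i
  fin_cases i <;> simp [DvQ, vQ, nQ, e, crd] <;> ring

/-- **First component of `curl nQ`**: `⟪curl nQ (y), e₀⟫ = 3 y₂² − y₁²`. [folklore] -/
theorem curl_nQ_zero (y : ℝ³) : curl nQ y 0 = 3 * y 2 ^ 2 - y 1 ^ 2 := by
  rw [curl, (hasFDerivAt_nQ y).fderiv]
  simp [DnQ, e, crd]

/-! ## Second derivatives: `Δ vQ = 0`, `Δ (3y₂² − y₁²) = 4` -/

/-- The partial derivatives of `vQ`: `∂₀vQ = y₂ e₁`, `∂₁vQ = 2y₁ e₀`, `∂₂vQ = −2y₂ e₀ + y₀ e₁`.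
[folklore] -/
theorem fderiv_vQ_e (z : ℝ³) :
    fderiv ℝ vQ z (e 0) = (z 2) • e 1 ∧ fderiv ℝ vQ z (e 1) = (2 * z 1) • e 0 ∧
      fderiv ℝ vQ z (e 2) = (-2 * z 2) • e 0 + (z 0) • e 1 := by
  rw [(hasFDerivAt_vQ z).fderiv]
  refine ⟨?_, ?_, ?_⟩ <;> ext i <;> fin_cases i <;> simp [DvQ, e, crd]

/-- **`vQ` is harmonic**: `Δ vQ = 0` (`Δ(y₁² − y₂²) = 2 − 2`, `Δ(y₀y₂) = 0`). [folklore] -/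
theorem laplacian_vQ (y : ℝ³) : Δ vQ y = 0 := by
  rw [laplacian_eq_sum_fderiv_fderiv (EuclideanSpace.basisFun (Fin 3) ℝ)
    (contDiff_infty.1 contDiff_vQ 2) y, Fin.sum_univ_three]
  simp only [EuclideanSpace.basisFun_apply]
  have h0 : (fun z : ℝ³ => fderiv ℝ vQ z (EuclideanSpace.single 0 1)) = fun z => (z 2) • e 1 :=
    funext fun z => (fderiv_vQ_e z).1
  have h1 : (fun z : ℝ³ => fderiv ℝ vQ z (EuclideanSpace.single 1 1)) = fun z => (2 * z 1) • e 0 :=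
    funext fun z => (fderiv_vQ_e z).2.1
  have h2 : (fun z : ℝ³ => fderiv ℝ vQ z (EuclideanSpace.single 2 1)) =
      fun z => (-2 * z 2) • e 0 + (z 0) • e 1 :=
    funext fun z => (fderiv_vQ_e z).2.2
  have h2' : HasFDerivAt (fun z : ℝ³ => (-2 * z 2) • e 0 + (z 0) • e 1)
      (((-2 : ℝ) • crd 2).smulRight (e 0) + (crd 0).smulRight (e 1)) y :=
    ((((hasFDerivAt_coord 2 y).const_mul (-2)).smul_const (e 0)).add
      ((hasFDerivAt_coord 0 y).smul_const (e 1)))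
  rw [h0, h1, h2, ((hasFDerivAt_coord 2 y).smul_const (e 1)).fderiv,
    (((hasFDerivAt_coord 1 y).const_mul 2).smul_const (e 0)).fderiv, h2'.fderiv]
  ext i
  fin_cases i <;> simp [e, crd]

/-- **`Δ (3y₂² − y₁²) = 4`** (the scalar `⟪curl nQ, e₀⟫`; `6 − 2 = 4`). [folklore] -/
theorem laplacian_curl_nQ_zero (y : ℝ³) :
    (Δ (fun z : ℝ³ => (3 * z 2 ^ 2 - z 1 ^ 2 : ℝ))) y = 4 := by
  have hq : ContDiff ℝ 2 (fun z : ℝ³ => 3 * z 2 ^ 2 - z 1 ^ 2) := by fun_prop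
  have hD : ∀ z : ℝ³, HasFDerivAt (fun z : ℝ³ => 3 * z 2 ^ 2 - z 1 ^ 2)
      ((6 * z 2) • crd 2 - (2 * z 1) • crd 1) z := fun z => by
    have := (((hasFDerivAt_coord 2 z).pow 2).const_mul (3 : ℝ)).sub ((hasFDerivAt_coord 1 z).pow 2)
    refine this.congr_fderiv ?_
    ext h
    simp [crd]
    ring
  rw [laplacian_eq_sum_fderiv_fderiv (EuclideanSpace.basisFun (Fin 3) ℝ) hq y, Fin.sum_univ_three]
  simp only [EuclideanSpace.basisFun_apply]
  have h0 : (fun z : ℝ³ => fderiv ℝ (fun z : ℝ³ => 3 * z 2 ^ 2 - z 1 ^ 2) z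
      (EuclideanSpace.single 0 1)) = fun _ => (0 : ℝ) := funext fun z => by
    rw [(hD z).fderiv]; simp [crd]
  have h1 : (fun z : ℝ³ => fderiv ℝ (fun z : ℝ³ => 3 * z 2 ^ 2 - z 1 ^ 2) z
      (EuclideanSpace.single 1 1)) = fun z => -2 * z 1 := funext fun z => by
    rw [(hD z).fderiv]; simp [crd]
  have h2 : (fun z : ℝ³ => fderiv ℝ (fun z : ℝ³ => 3 * z 2 ^ 2 - z 1 ^ 2) z
      (EuclideanSpace.single 2 1)) = fun z => 6 * z 2 := funext fun z => by
    rw [(hD z).fderiv]; simp [crd]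
  rw [h0, h1, h2, fderiv_const_apply, ((hasFDerivAt_coord 1 y).const_mul (-2)).fderiv,
    ((hasFDerivAt_coord 2 y).const_mul 6).fderiv]
  simp [crd]
  norm_num

end BumpWitness

end Summit.NavierStokesRegularity.FunctionalMining

end
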